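import Summits.BirchSwinnertonDyer.BirchSwinnertonDyer.Theorems.QuadraticBranchSignedControlPlusEtaNonsurjFineRoadAnchor
import Summits.BirchSwinnertonDyer.BirchSwinnertonDyer.Theorems.QuadraticBranchSignedControlPlusEtaCMRowsUpToMu
import Summits.BirchSwinnertonDyer.BirchSwinnertonDyer.Theorems.QuadraticBranchSignedControlTwistPartnerModel
import HarnessLib

/-!
# Route `QuadraticBranchSignedControl` (rung K8, cell `bsd-potss`), residual crux
# `PlusEtaMainConjectureNonsurj` (stmt-BirchSwinnertonDyer-19606): the FINE ROAD, part 5 — the CM primary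
# stub `stub_etaMC_cm` IS «(A) on the CM partners + analytic `μ`» modulo Burungale–Tian 2026 (seat k8eta-c2 g7)

WHAT. Skeleton v5 of crux 19606 (plan g23) keeps FOUR primary stubs (`stub_etaMC_thm22` cite ·
`stub_etaMC_cm` · `stub_etaMC_nonCM_upper` · `stub_etaMC_nonCM_lower`) and the sub-cut stub
`stub_conjA_partners` = statement (A) of Coates–Sujatha for the ADDITIVE partner `W` of every non-onto
Gss2 twist `V` (`C • W^{(p*)} = V`). Seat k8q-c2 g3 proved (`EtaCMUpToMu`, p478350) that on the CM rows
(C1⁺_η)(V,p) is EQUIVALENT to the `μ`-equality `μ(X⁺(V/K_∞)^η) = μ(Λ/(L_p⁺(V,η,X)))` on every `η`-datum,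
modulo Burungale–Tian 2026 Thm. 2.6 (`h26`, Kato's main conjecture `⊗ ℚ` for CM newforms ∘ Kobayashi) and
Kobayashi's Thm. 2.2 at `η` (`h22`). Seat k8eta-c2 g6 proved (`EtaFineRoad`, p527998) that on EVERY row
`μ(X⁺(V/K_∞)^η) = 0` follows from (A)(W,p) and the analytic `μ(L_p⁺(V,η,X)) = 0`, modulo Kobayashi's
Thm. 6.2/6.3/7.3 i)/Cor. 7.2 at `η` (`h6273`). THIS FILE composes the two:

* §1 `muInvariant_quotient_span_eq_zero_of_hasUnitContent` — `μ(Λ/(L)) = 0` for `L` of unit content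
  (`char(Λ/(L)) = (L)`, Greenberg–Vatsal's reading of `μ = 0`; `Λ`-algebra only).
* §2 `etaMC_cmRows_of_bt26_of_conjA_of_analyticMu` — **on every CM row of crux 19606, of ANY rank,
  (C1⁺_η)(V,p) ⟸ (A)(W,p) ∧ `μ(L_p⁺(V,η,X)) = 0`**, modulo `h26`, `h22`, `h6273`: both `μ`-invariants
  vanish, so the `μ`-equality holds and `EtaCMUpToMu.quadraticBranchPlusEtaMainConjectureAt_iff_muInvariant_eq_of_cm`
  concludes. No rank hypothesis, no `L`-value, no Poitou–Tate over `ℚ`, no bsd.S28, no 19116, no image hypothesis.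
* §3 `etaMC_cm_of_bt26_of_conjA_partners_of_analyticMu` — the ∀-form on the skeleton's binders: the TEXT of
  the registered `Sig.stub_etaMC_cm` follows from the TEXT of the registered `Sig.stub_conjA_partners`
  (restricted to CM twists) and the displayed analytic input `AnalyticEtaMuZeroAt V p` on the CM rows, modulo
  `h26 h22 h6273` (the partner `W` of a given `V` exists by `TwistPartner.exists_isGloballyMinimal_pStarPartner`).

EFFECT ON THE RECORD (honest). With v5's compositions (`etaMC_r0_of_conjA_of_analyticMu`,
`etaUpper_r0r1_of_conjA_of_analyticMu`, `etaMC_r1_of_conjA`) the non-CM rank-0 rows, the integral upper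
inclusion on every row and the prime-`L` rank-1 rows already read «(A)(W,p) + analytic `μ`»; §3 adds ALL CM
rows of every rank (in-table at `p = 5`, `N_W < 5·10⁵`: 192 + 274 + 43 CM pairs; class-wide every CM twist),
at the price of ONE more named fact (`h26`, Annals 2026). So a skeleton v6 may DROP the primary stub
`stub_etaMC_cm` in favour of `stub_conjA_partners` + the displayed analytic `μ` + `h26`: after it, crux 19606
modulo named facts = (A) on the partners + analytic `μ` + L₀ on the non-CM rank-0 rows + the Eisenstein
inclusion (E⁺_η) on the non-CM rows of rank ≥ 1 with non-prime `L_p⁺` (the residual content of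
`stub_etaMC_nonCM_lower`). Nothing here proves (A), the analytic `μ`, or any stub by name.

HONEST FRAMING (cell `bsd-potss`; FULL-BSD rank ≤ 1 programme, HUMAN RULING D-0036/D-0074): BOOKKEEPING
THEOREMS ONLY — no definition, no named fact minted, no `sorry`, axioms standard. CONDITIONAL on the displayed
named facts `h26` (`BurungaleTian2026.thm26_etaKatoSequences_charIdeal_upToP_of_cm`, NOT proved in the tree),
`h22`, `h6273` (Kobayashi 2003, NOT proved in the tree) and on the displayed inputs ((A)(W,p) — OPEN class-wide,
Coates–Sujatha's conjecture; the analytic `μ = 0` — certified per row, k8eta-c2 g3, 537/537). The crux, its CM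
stub and Conjecture A stay OPEN; nothing is booked; `BSD(W,p)` is claimed for no pair.
`--supports stmt-BirchSwinnertonDyer-19606`.

References: [BurungaleTian2026] Thm. 2.6 and Rem. 2.7 (p. 5); [Kobayashi2003] §4 Even main conjecture (p. 8),
Thm. 2.2 (p. 5), Thm. 7.3 i) (7.21) and Cor. 7.2 (p. 13); [CoatesSujatha2005] §3 statement (A);
[GreenbergVatsal2000] p. 2 (1)–(2); [PollackRubin2004] Theorem and remark p. 448; [Washington1997] §13.2.
-/

set_option autoImplicit false
set_option linter.dupNamespace false

noncomputable section

open scoped Classical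

open CongruenceSubgroup Field Function NumberField IsDedekindDomain WeierstrassCurve
open Literature.NumberTheory.EllipticCurves
open Literature.NumberTheory.EllipticCurves.ModularForms
open Literature.NumberTheory.EllipticCurves.Rank1Residual
open Literature.NumberTheory.EllipticCurves.Rank1Residual.Typed
open Literature.NumberTheory.GaloisRepresentations
open Literature.NumberTheory.GaloisCohomology
open Literature.NumberTheory.EllipticCurves.IwasawaAlgebra
open Literature.NumberTheory.EllipticCurves.IwasawaDual ZpExtension
open Literature.NumberTheory.EllipticCurves.GreenbergVatsal2000
open Summit.BirchSwinnertonDyer.Rank1Residual.X11b.Levels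
open Summit.BirchSwinnertonDyer.Rank1Residual.X11b
open Summit.BirchSwinnertonDyer.Rank1Residual.Additive
open Summit.BirchSwinnertonDyer.Rank1Residual.Additive.SignedTwist
open scoped ContRepresentation
open Summit.BirchSwinnertonDyer.Rank1Residual.AdditivePotMult

namespace Summit.BirchSwinnertonDyer.BirchSwinnertonDyer.Theorems

namespace EtaFineRoad

/-! ## §1 `Λ`-algebra: `μ(Λ/(L)) = 0` for `L` of unit content -/

section Algebra

variable {p : ℕ} [Fact p.Prime]

/-- `Λ/(L)` is a torsion `Λ`-module for `L ≠ 0` (`Λ = ℤ_p⟦X⟧` a domain). [folklore] -/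
theorem isTorsion_quotient_span_singleton {L : IwasawaAlgebra p} (hL : L ≠ 0) :
    Module.IsTorsion (IwasawaAlgebra p) (IwasawaAlgebra p ⧸ Ideal.span {L}) := by
  intro x
  refine ⟨⟨L, mem_nonZeroDivisors_of_ne_zero hL⟩, ?_⟩
  obtain ⟨r, rfl⟩ := Ideal.Quotient.mk_surjective x
  change L • Ideal.Quotient.mk (Ideal.span {L}) r = 0
  rw [← Ideal.Quotient.mk_eq_mk, ← Submodule.Quotient.mk_smul, Submodule.Quotient.mk_eq_zero,
    smul_eq_mul]
  exact Ideal.mul_mem_right _ _ (Ideal.mem_span_singleton_self L)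

/-- **`μ(Λ/(L)) = 0` when `L` has unit content** — Greenberg–Vatsal's reading (2) of `μ = 0` for the cyclic
torsion module `Λ/(L)`, whose characteristic ideal is `(L)` (Washington §13.2). For `L = L_p⁺(V,η,X)` this is
the analytic `μ`-invariant of crux 19606's displayed input. `Λ`-algebra only. [cite: GreenbergVatsal2000, p. 2 (1)–(2)]
[cite: Washington1997, §13.2] -/
theorem muInvariant_quotient_span_eq_zero_of_hasUnitContent {L : IwasawaAlgebra p} (hL : HasUnitContent L) :
    muInvariant p (IwasawaAlgebra p ⧸ Ideal.span {L}) = 0 :=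
  have hL0 : L ≠ 0 := Summit.BirchSwinnertonDyer.Rank1Residual.X11a.ne_zero_of_hasUnitContent hL
  (muInvariant_eq_zero_iff_hasUnitContent (IwasawaAlgebra p ⧸ Ideal.span {L})
    (isTorsion_quotient_span_singleton hL0) (BurungaleTian2026.charIdeal_quotient_span_singleton hL0)).mpr hL

end Algebra

/-! ## §2 The CM rows of crux 19606, any rank: (C1⁺_η)(V,p) ⟸ (A)(W,p) + analytic `μ`, modulo BT26 + Kob03 -/

/-- **19606 on its CM rows of ANY rank ⟸ (A) on the CM partner + the analytic `μ`, modulo Burungale–Tian.**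
For `p ≥ 5`, a CM twist `V` good at `p` with `a_p(V) = 0` (the `¬ onto` binder idle — CM images are never
onto), its additive partner `W` (`C • W^{(p*)} = V`), statement (A) of Coates–Sujatha at `(W,p)` in the cell's
`∃ γ D` currency and `μ(L_p⁺(V,η,X)) = 0` for every plus `p`-adic `L`-function at `η` (unit content):
`QuadraticBranchPlusEtaMainConjectureAt V p`. Proof: by `EtaCMUpToMu.quadraticBranchPlusEtaMainConjectureAt_iff_muInvariant_eq_of_cm`
(`h26`, `h22`) it suffices to show `μ(D.X) = μ(Λ/(Lη))` on every `η`-datum; the right side is `0` by §1, the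
left side is `0` because every characteristic generator of `D` has unit content
(`eta_hasUnitContent_of_conjA_of_analyticMu`, the fine road, `h6273`) and `D.X` is finitely generated torsion
(`h22`). No rank hypothesis, no `L`-value, no Poitou–Tate over `ℚ`, no bsd.S28, no 19116, no image hypothesis.
CONDITIONAL on `h26`, `h22`, `h6273` and the two displayed inputs; no stub proved by name; nothing booked.
[cite: BurungaleTian2026, Thm. 2.6 and Rem. 2.7 (p. 5)] [cite: Kobayashi2003, §4 (p. 8), Thm. 2.2 (p. 5), Thm. 7.3 i) (7.21) and Cor. 7.2 (p. 13)]
[cite: CoatesSujatha2005, §3 statement (A)] [cite: GreenbergVatsal2000, p. 2 (2)] -/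
theorem etaMC_cmRows_of_bt26_of_conjA_of_analyticMu
    (h26 : BurungaleTian2026.thm26_etaKatoSequences_charIdeal_upToP_of_cm)
    (h22 : Kobayashi2003.thm22_etaSignedSelmerDual_finite_torsion)
    (h6273 : Kobayashi2003.thm62_63_73_etaColemanPoitouTate) :
    ∀ (V : WeierstrassCurve ℚ) [V.IsElliptic] [V.IsGloballyMinimal] (p : ℕ) [Fact p.Prime],
      5 ≤ p → V.HasGoodReductionAtPrime p → V.frobeniusTrace p = 0 →
      ¬ (∀ m : ℕ, V.HasSurjectiveModNGaloisRep (p ^ m : ℕ)) → V.HasCM →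
      ∀ (W : WeierstrassCurve ℚ) [W.IsElliptic] [W.IsGloballyMinimal] (C : VariableChange ℚ),
        C • W.quadraticTwist ((-1) ^ (p / 2) * p) = V →
        (∀ (κ : ZpExtension ℚ p), κ.IsCyclotomic →
          ∃ (γ : absoluteGaloisGroup ℚ) (D : W.FineSelmerDualData κ γ),
            Module.Finite ℤ_[p] (RestrictScalars ℤ_[p] (IwasawaAlgebra p) D.X)) →
        (∀ {N : ℕ} [NeZero N] {f : CuspForm (Gamma0 N) 2}, IsNewformOf V f →
          ∀ (ϖ : ℚ), (if Even (p / 2) then (ϖ : ℝ) * V.realPeriodRat = plusPeriod f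
              else (ϖ : ℝ) * V.imaginaryPeriodRat = minusPeriod f) →
          ∀ (Lη : IwasawaAlgebra p), IsQuadraticBranchPlusLFunction f p ϖ Lη → HasUnitContent Lη) →
        QuadraticBranchPlusEtaMainConjectureAt V p := by
  intro V _ _ p _ hp5 hgood hap _ hCM W _ _ C hCV hA hμan
  have hp2 : p ≠ 2 := by omega
  refine (EtaCMUpToMu.quadraticBranchPlusEtaMainConjectureAt_iff_muInvariant_eq_of_cm h26 h22 hCM).mpr ?_
  intro K₀ _ _ _ _ ηq hηK hη1 N _ f _ hgood' hap' hf ϖ hϖ Lη hL κ γ hκ hγ hγK hγc D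
  -- the analytic side: `μ(Λ/(Lη)) = 0`
  have hR : muInvariant p (IwasawaAlgebra p ⧸ Ideal.span {Lη}) = 0 :=
    muInvariant_quotient_span_eq_zero_of_hasUnitContent (hμan hf ϖ hϖ Lη hL)
  -- the algebraic side: `μ(X⁺(V/K_∞)^η) = 0` by the fine road
  obtain ⟨hfin, htor⟩ :=
    EtaSignedSelmerDualData.finite_isTorsion_of_thm22 h22 hηK hp2 hgood hap hκ hγ hγK D
  obtain ⟨g, -, hg⟩ := BurungaleTian2026.exists_charIdeal_eq_span_ne_zero (p := p) D.X
  have hu : HasUnitContent g :=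
    eta_hasUnitContent_of_conjA_of_analyticMu W p h6273 V C hCV hA hμan K₀ ηq hηK hη1 hp2 hgood hap hf ϖ
      hϖ κ γ hκ hγ hγK hγc D g hg
  haveI := hfin
  have hL : muInvariant p D.X = 0 := (muInvariant_eq_zero_iff_hasUnitContent D.X htor hg).mpr hu
  rw [hL, hR]

/-! ## §3 The ∀-form on skeleton v5's binders: `stub_etaMC_cm` ⟸ `stub_conjA_partners`|CM + analytic `μ` -/

/-- **The TEXT of 19606's registered CM stub `Sig.stub_etaMC_cm` from the TEXT of the registered sub-cut stub
`Sig.stub_conjA_partners` (used on CM twists only) and the displayed analytic input `AnalyticEtaMuZeroAt V p` on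
the CM rows, modulo `h26`, `h22`, `h6273`.** The additive partner of a given `V` is supplied by
`TwistPartner.exists_isGloballyMinimal_pStarPartner` (every `V/ℚ` is `C • W^{(p*)}` with `W` globally minimal).
For the planner: with this and v5's `etaMC_r0_of_conjA_of_analyticMu` / `etaUpper_r0r1_of_conjA_of_analyticMu` /
`etaMC_r1_of_conjA`, a skeleton v6 may replace the primary stub `stub_etaMC_cm` by `stub_conjA_partners` +
the displayed analytic `μ` + the named fact `h26`. CONDITIONAL; no stub proved by name; nothing booked.
[cite: BurungaleTian2026, Thm. 2.6 and Rem. 2.7 (p. 5)] [cite: Kobayashi2003, §4 (p. 8), Thm. 2.2 (p. 5), Thm. 7.3 i) (p. 13)]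
[cite: CoatesSujatha2005, §3 statement (A)] [cite: PollackRubin2004, Theorem and remark p. 448] -/
theorem etaMC_cm_of_bt26_of_conjA_partners_of_analyticMu
    (h26 : BurungaleTian2026.thm26_etaKatoSequences_charIdeal_upToP_of_cm)
    (h22 : Kobayashi2003.thm22_etaSignedSelmerDual_finite_torsion)
    (h6273 : Kobayashi2003.thm62_63_73_etaColemanPoitouTate)
    (hA : ∀ (V : WeierstrassCurve ℚ) [V.IsElliptic] [V.IsGloballyMinimal] (W : WeierstrassCurve ℚ) [W.IsElliptic]
      [W.IsGloballyMinimal] (C : VariableChange ℚ) (p : ℕ) [Fact p.Prime],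
      5 ≤ p → C • W.quadraticTwist ((-1) ^ (p / 2) * p) = V →
      V.HasGoodReductionAtPrime p → V.frobeniusTrace p = 0 →
      ¬ (∀ m : ℕ, V.HasSurjectiveModNGaloisRep (p ^ m : ℕ)) → V.HasCM →
      ∀ (κ : ZpExtension ℚ p), κ.IsCyclotomic →
        ∃ (γ : absoluteGaloisGroup ℚ) (D : W.FineSelmerDualData κ γ),
          Module.Finite ℤ_[p] (RestrictScalars ℤ_[p] (IwasawaAlgebra p) D.X))
    (hμan : ∀ (V : WeierstrassCurve ℚ) [V.IsElliptic] [V.IsGloballyMinimal] (p : ℕ) [Fact p.Prime],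
      5 ≤ p → V.HasGoodReductionAtPrime p → V.frobeniusTrace p = 0 →
      ¬ (∀ m : ℕ, V.HasSurjectiveModNGaloisRep (p ^ m : ℕ)) → V.HasCM →
      ∀ {N : ℕ} [NeZero N] {f : CuspForm (Gamma0 N) 2}, IsNewformOf V f →
        ∀ (ϖ : ℚ), (if Even (p / 2) then (ϖ : ℝ) * V.realPeriodRat = plusPeriod f
            else (ϖ : ℝ) * V.imaginaryPeriodRat = minusPeriod f) →
        ∀ (Lη : IwasawaAlgebra p), IsQuadraticBranchPlusLFunction f p ϖ Lη → HasUnitContent Lη) :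
    ∀ (V : WeierstrassCurve ℚ) [V.IsElliptic] [V.IsGloballyMinimal] (p : ℕ) [Fact p.Prime],
      5 ≤ p → V.HasGoodReductionAtPrime p → V.frobeniusTrace p = 0 →
      ¬ (∀ m : ℕ, V.HasSurjectiveModNGaloisRep (p ^ m : ℕ)) → V.HasCM →
        QuadraticBranchPlusEtaMainConjectureAt V p := by
  intro V _ _ p _ hp5 hgood hap hns hCM
  obtain ⟨W, _, _, C, hCV⟩ := TwistPartner.exists_isGloballyMinimal_pStarPartner V p
  exact etaMC_cmRows_of_bt26_of_conjA_of_analyticMu h26 h22 h6273 V p hp5 hgood hap hns hCM W C hCV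
    (hA V W C p hp5 hCV hgood hap hns hCM) (hμan V p hp5 hgood hap hns hCM)

end EtaFineRoad

end Summit.BirchSwinnertonDyer.BirchSwinnertonDyer.Theorems

end
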